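import Summits.CriticalPhenomena.Ising3DConformalLimit.Theorems.EnergyNotSigmaSquaredMoebiusLimitExistsOneMapOneJetReduction
import Summits.CriticalPhenomena.Ising3DConformalLimit.Theorems.EnergyNotSigmaSquaredMoebiusLimitExistsOneMapOneJetAnalyticity
import Summits.CriticalPhenomena.Ising3DConformalLimit.Theorems.EnergyNotSigmaSquaredMoebiusLimitExistsHrpFactorisation
import HarnessLib

/-!
# The crux `MoebiusLimitExists` IS "existence + even inversion germs"
(crux item stmt-CriticalPhenomena-1344, line `one-map-one-jet`, lead c5, 2026-08-16; `--supports stmt-CriticalPhenomena-1344`)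

With nine-mirror analyticity a THEOREM (`stub_nineMirrorAnalyticity`, p121553) the reduction of the line
(`MoebiusLimitExists_of_analyticity_of_evenGerm`, `…OneMapOneJetReduction.lean`) loses its analyticity
hypothesis, and the crux factorises EXACTLY through

* item stmt-CriticalPhenomena-1981 `HyperoctahedralRP.ExistsScaleCovariantLimit` (existence of a normalised,
  non-degenerate, translation-invariant, scale-covariant limit — NO rotations), and
* (G) EVEN INVERSION GERMS — the one registered stub left on the line, `stub_inversionGerm_even_ge_four`:
  for every such limit that is continuous off the diagonals and real-analytic on the good configurations
  (both now automatic), at every even order `n ≥ 4`, every doubly-good configuration is joined inside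
  `InvGoodConfig n` to a point where the germ of the inversion defect vanishes.

Main results: `MoebiusLimitExists_of_evenGerm : (G) → 1981 → crux` (registered anchor; no rotation item, no
`HRP2Rigidity`, no analyticity hypothesis), `MoebiusLimitExists_iff_exists_and_evenGerm : crux ↔ 1981 ∧ (G)`,
and `evenGerm_iff_hrp_of_exists : 1981 → ((G) ↔ LimitRotationInvariant ∧ InversionUpgradeNormalised)` —
under existence, the single germ statement (G) is EQUIVALENT to the conjunction of the two covariance cruxes
1980 ∧ 1982 of route HyperoctahedralRP (compare `MoebiusLimitExists_iff_hrp`, lead c4). So (G) is honestly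
crux-sized: it is the covariance content of the 3D-Ising conformal-invariance conjecture, re-cut as a local,
graded statement about one analytic family (order 0 free on the fixed sphere; order 1 = the equal-radial-weights
law, `radialLaw_of_inversionGerm`).
-/

noncomputable section

open Set Function Filter EuclideanGeometry
open scoped Topology
open Literature.Probability.LatticeModels

namespace Summit.CriticalPhenomena.Ising3DConformalLimit.MoebiusLimitExistsOneMapOneJet

/-- **Registered anchor `MoebiusLimitExists_of_evenGerm`: (G) and existence give the crux.** The reduction
`MoebiusLimitExists_of_analyticity_of_evenGerm` with its analyticity hypothesis discharged by the theorem
`stub_nineMirrorAnalyticity`. [folklore] -/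
theorem MoebiusLimitExists_of_evenGerm :
    (∀ (ρ : ℝ → ℝ) (Δ : ℝ) (S : CorrFamily 3), (∀ δ ∈ Set.Ioc (0:ℝ) 1, 0 < ρ δ) → 0 < Δ →
      HasPointwiseScalingLimit (criticalCorr 3) ρ S →
      (∀ n z, z ∉ NonCoincident 3 n → S n z = 0) → IsNondegenerateTwoPoint S →
      IsTranslationInvariant S → IsScaleCovariant Δ S →
      (∀ n, ContinuousOn (S n) (NonCoincident 3 n)) →
      (∀ n, AnalyticOnNhd ℝ (S n) (GoodConfig n)) →
      ∀ n, 4 ≤ n → Even n → ∀ x ∈ InvGoodConfig n, ∃ x₀, JoinedIn (InvGoodConfig n) x x₀ ∧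
        inversionDefect Δ S n =ᶠ[𝓝 x₀] 0) →
    Theses.HyperoctahedralRP.ExistsScaleCovariantLimit →
    Theses.PerfectScreening.MoebiusLimitExists :=
  fun hG hE => MoebiusLimitExists_of_analyticity_of_evenGerm stub_nineMirrorAnalyticity hG hE

/-- **THE CRUX IS "EXISTENCE + EVEN INVERSION GERMS"**: `MoebiusLimitExists ↔ ExistsScaleCovariantLimit ∧ (G)`.
`⇒`: the crux implies item 1981 (`existsScaleCovariantLimit_of_MoebiusLimitExists`, lead c4) and (G)
(`stub_inversionGerm_even_ge_four_of_crux`); `⇐`: `MoebiusLimitExists_of_evenGerm`. [folklore] -/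
theorem MoebiusLimitExists_iff_exists_and_evenGerm :
    Theses.PerfectScreening.MoebiusLimitExists ↔
      (Theses.HyperoctahedralRP.ExistsScaleCovariantLimit ∧
        ∀ (ρ : ℝ → ℝ) (Δ : ℝ) (S : CorrFamily 3), (∀ δ ∈ Set.Ioc (0:ℝ) 1, 0 < ρ δ) → 0 < Δ →
          HasPointwiseScalingLimit (criticalCorr 3) ρ S →
          (∀ n z, z ∉ NonCoincident 3 n → S n z = 0) → IsNondegenerateTwoPoint S →
          IsTranslationInvariant S → IsScaleCovariant Δ S →
          (∀ n, ContinuousOn (S n) (NonCoincident 3 n)) →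
          (∀ n, AnalyticOnNhd ℝ (S n) (GoodConfig n)) →
          ∀ n, 4 ≤ n → Even n → ∀ x ∈ InvGoodConfig n, ∃ x₀, JoinedIn (InvGoodConfig n) x x₀ ∧
            inversionDefect Δ S n =ᶠ[𝓝 x₀] 0) :=
  ⟨fun h => ⟨Summit.CriticalPhenomena.Ising3DConformalLimit.MoebiusLimitExistsOnlyInteraction.existsScaleCovariantLimit_of_MoebiusLimitExists h,
      stub_inversionGerm_even_ge_four_of_crux h⟩,
    fun h => MoebiusLimitExists_of_evenGerm h.2 h.1⟩

/-- The same for the primary route's spelling `EnergyNotSigmaSquared.MoebiusLimit` (one term). [folklore] -/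
theorem MoebiusLimit_iff_exists_and_evenGerm :
    Theses.EnergyNotSigmaSquared.MoebiusLimit ↔
      (Theses.HyperoctahedralRP.ExistsScaleCovariantLimit ∧
        ∀ (ρ : ℝ → ℝ) (Δ : ℝ) (S : CorrFamily 3), (∀ δ ∈ Set.Ioc (0:ℝ) 1, 0 < ρ δ) → 0 < Δ →
          HasPointwiseScalingLimit (criticalCorr 3) ρ S →
          (∀ n z, z ∉ NonCoincident 3 n → S n z = 0) → IsNondegenerateTwoPoint S →
          IsTranslationInvariant S → IsScaleCovariant Δ S →
          (∀ n, ContinuousOn (S n) (NonCoincident 3 n)) →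
          (∀ n, AnalyticOnNhd ℝ (S n) (GoodConfig n)) →
          ∀ n, 4 ≤ n → Even n → ∀ x ∈ InvGoodConfig n, ∃ x₀, JoinedIn (InvGoodConfig n) x x₀ ∧
            inversionDefect Δ S n =ᶠ[𝓝 x₀] 0) :=
  MoebiusLimitExists_iff_exists_and_evenGerm

/-- **Under existence, (G) ⟺ 1980 ∧ 1982.** Given item 1981, the single germ statement (G) is equivalent to the
conjunction of the two covariance cruxes of route HyperoctahedralRP (`LimitRotationInvariant`, item 1980, and
`InversionUpgradeNormalised`, item 1982): `⇐` is `stub_inversionGerm_even_ge_four_of_items`; `⇒` goes through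
the crux (`MoebiusLimitExists_of_evenGerm`, then `limitRotationInvariant_of_MoebiusLimitExists` /
`inversionUpgradeNormalised_of_MoebiusLimitExists`). [folklore] -/
theorem evenGerm_iff_hrp_of_exists (hE : Theses.HyperoctahedralRP.ExistsScaleCovariantLimit) :
    (∀ (ρ : ℝ → ℝ) (Δ : ℝ) (S : CorrFamily 3), (∀ δ ∈ Set.Ioc (0:ℝ) 1, 0 < ρ δ) → 0 < Δ →
      HasPointwiseScalingLimit (criticalCorr 3) ρ S →
      (∀ n z, z ∉ NonCoincident 3 n → S n z = 0) → IsNondegenerateTwoPoint S →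
      IsTranslationInvariant S → IsScaleCovariant Δ S →
      (∀ n, ContinuousOn (S n) (NonCoincident 3 n)) →
      (∀ n, AnalyticOnNhd ℝ (S n) (GoodConfig n)) →
      ∀ n, 4 ≤ n → Even n → ∀ x ∈ InvGoodConfig n, ∃ x₀, JoinedIn (InvGoodConfig n) x x₀ ∧
        inversionDefect Δ S n =ᶠ[𝓝 x₀] 0) ↔
    (Theses.HyperoctahedralRP.LimitRotationInvariant ∧ Theses.HyperoctahedralRP.InversionUpgradeNormalised) := by
  constructor
  · intro hG
    have h := MoebiusLimitExists_of_evenGerm hG hE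
    exact ⟨Summit.CriticalPhenomena.Ising3DConformalLimit.MoebiusLimitExistsOnlyInteraction.limitRotationInvariant_of_MoebiusLimitExists h,
      Summit.CriticalPhenomena.Ising3DConformalLimit.MoebiusLimitExistsOnlyInteraction.inversionUpgradeNormalised_of_MoebiusLimitExists h⟩
  · rintro ⟨h1980, h1982⟩
    exact stub_inversionGerm_even_ge_four_of_items h1980 h1982

/-- **Inversion covariance of every analytic 1981-type limit from (G)** — with continuity and analyticity now
automatic, (G) alone makes every normalised, non-degenerate, translation-invariant, scale-covariant limit of
the critical `ℤ³` correlators inversion covariant (and hence, by item 4675, fully Möbius covariant). [folklore] -/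
theorem isInversionCovariant_of_evenGerm'
    (hG : ∀ (ρ : ℝ → ℝ) (Δ : ℝ) (S : CorrFamily 3), (∀ δ ∈ Set.Ioc (0:ℝ) 1, 0 < ρ δ) → 0 < Δ →
      HasPointwiseScalingLimit (criticalCorr 3) ρ S →
      (∀ n z, z ∉ NonCoincident 3 n → S n z = 0) → IsNondegenerateTwoPoint S →
      IsTranslationInvariant S → IsScaleCovariant Δ S →
      (∀ n, ContinuousOn (S n) (NonCoincident 3 n)) →
      (∀ n, AnalyticOnNhd ℝ (S n) (GoodConfig n)) →
      ∀ n, 4 ≤ n → Even n → ∀ x ∈ InvGoodConfig n, ∃ x₀, JoinedIn (InvGoodConfig n) x x₀ ∧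
        inversionDefect Δ S n =ᶠ[𝓝 x₀] 0)
    {ρ : ℝ → ℝ} {Δ : ℝ} {S : CorrFamily 3}
    (hρ : ∀ δ ∈ Set.Ioc (0:ℝ) 1, 0 < ρ δ) (hΔ : 0 < Δ) (hlim : HasPointwiseScalingLimit (criticalCorr 3) ρ S)
    (hnorm : ∀ n z, z ∉ NonCoincident 3 n → S n z = 0) (hnd : IsNondegenerateTwoPoint S)
    (htr : IsTranslationInvariant S) (hsc : IsScaleCovariant Δ S) :
    IsInversionCovariant Δ S := by
  have hcont : ∀ n, ContinuousOn (S n) (NonCoincident 3 n) :=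
    Summit.CriticalPhenomena.Ising3DConformalLimit.LimitMeshContinuity.continuousOn_limit_of_translationInvariant
      hlim htr
  have han : ∀ n, AnalyticOnNhd ℝ (S n) (GoodConfig n) :=
    stub_nineMirrorAnalyticity ρ Δ S hρ hΔ hlim hnorm hnd htr hsc hcont
  exact isInversionCovariant_of_evenGerm hρ hlim hnorm hnd htr hsc han
    (hG ρ Δ S hρ hΔ hlim hnorm hnd htr hsc hcont han)

end Summit.CriticalPhenomena.Ising3DConformalLimit.MoebiusLimitExistsOneMapOneJet

end
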